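import Summits.BirchSwinnertonDyer.BirchSwinnertonDyer.Theorems.KimAtThreeTwoExponentWitnessPairStable
import Summits.BirchSwinnertonDyer.BirchSwinnertonDyer.Theorems.KimAtThreeTwoExponentPortOfZetaBodyU
import Summits.BirchSwinnertonDyer.BirchSwinnertonDyer.Theorems.KimAtThreeDeepLowerOffStratumAdditiveDefectPortTwoExp
import Summits.BirchSwinnertonDyer.BirchSwinnertonDyer.Theorems.KimAtThreeDeepUpperCertSupplyDefect
import HarnessLib

/-!
# Route `KimAtThreeKolyvagin` (rung W2), crux 19679 (`DeepLowerAtThreeOffKatoStratum`), stub `stub_additiveDefect`: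
# the LOWER END at EVERY `3`-torsion exponent `t`, PORT-FREE, straight from Kato's `ZetaBody` —
# Kim's Theorem A-t (ii), LOWER half, in the kernel (cell `bsd-addord`, seat `bsd-addord-w2-acc3` gen 4)

HONEST FRAMING. END-TYPE TOOL theorems with DISPLAYED hypotheses (no definition, no named fact, no instance, no
`sorry`); nothing asserted about any curve; nothing booked; crux 19679 stays OPEN (its OWNER assembles).
`--supports` stmt-BirchSwinnertonDyer-19679.

## What and why

This seat's gen-2 LOWER END `KimAtThreeDeepLowerOffStratumAdditiveDefectPortTwoExpEnd.padicValRat_ratPlusSymbol_le_of_towerSurj_deep_twoExp`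
(§2 there) consumes the universal-closure port PORT₂ `KatoKuriharaPortThreeAtWith₂TwoExp W t e v₃ η P`, whose
With-guard puts the primes of a depth-`k` datum in the Frobenius class of depth `k + t`.  Kato's Euler system pays
the place `3` at depth `k` only with primes of level `3^{k+N₀+1}`, `N₀` a torsion-STABILISATION level of `E(ℚ₃)`
(Mazur–Rubin App. A Prop. A.2; this seat's `KimAtThreeDeepLowerKolyvaginPairStable` / ★★-stable
`KimAtThreeTwoExponentWitnessPairStable`): so PORT₂ is supplied at `N₀ = t` (★₂-stable), but NOT on the rows with a
`ℚ₃`-point of order `3^{t+1}` (`E(ℚ₃)[3^∞] ≅ ℤ/9`, `#E(ℚ₃)[3] = 3`: `N₀ = 2 > t = 1`).  But the END never needed the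
universal closure: it reads the dictionary on ONE deep family it builds itself (w2-c2's
`exists_deepFamily_of_towerSurj_with`, depth parameter free).  **This file re-runs the END with the family built at
depth parameter `N₀` instead of `t` and the dictionary fed DIRECTLY by ★★-stable** — no port predicate at all:

* §1 `padicValRat_ratPlusSymbol_le_of_towerSurj_deep_twoExp_of_zetaBody_of_stable` — gen-2 §2 with `hPort`
  REPLACED by Kato's `ZetaBody` (`hbody`, witnesses BOUND), the (Λ)-clauses `hΛ`, the TWO-EXPONENT riders `hfin₂` at
  torsion exponent `t`, `hcdA`, the level-free value certificates (n1011 T-PK6-VDIS), and `hstab` at ANY level `N₀`;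
  certificate level `k + N₀ + 1`, precision `t + j ≤ k + 1`.
* §2 `deepLower_datum_of_zetaBody_of_stable` — the row theorem (crux 19679's conclusion on an additive row, every
  `t`, `e`, `N₀`): gen-2 §3's END-shape bound at `K = t + N₀ + 1` over §1 at depth `k = L − N₀ − 1`.
* (sequel `KimAtThreeOffStratumTorsionRowsOfFineKato` §1) `N₀ = 2` holds on EVERY additive row (n1011-p13
  `hstab_two_of_hasAdditiveReductionAt`: `27·P = 0 → 9·P = 0` on `E(ℚ₃)`), so the row theorem needs NO torsion
  hypothesis there: crux 19679's conclusion on every additive optimal tower row of analytic rank `0`, every `t`, ⟸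
  S24-DEEP (1)(2) + GZK + PT + the ZetaBody package at torsion exponent `t` (the fine Kato package (C1₂ᵗ)).

NET: the `t ≥ 1` additive rows of 19679 — displayed VERBATIM as (R₁) by gen 3 — become THEOREMS modulo the same
construction-shaped object as the `t = 0` rows ((C1₂), `defn-BlochKatoDualExponential` lane) read at torsion exponent
`t`, INCLUDING the `ℤ/9` rows; sequel `KimAtThreeOffStratumTorsionRowsOfFineKato` runs the rows / stub layer.
HONEST LIMITS: S24-DEEP (1)(2) (FLAG `S24-DEEP-PORT@3`) enter through `exists_deepFamily_of_towerSurj_with` as in gen 2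
(discharged modulo the pinned [S24] facts by w2-c2 gen 5, not re-keyed here); riders / `hNorm` are hypotheses on
bound witnesses; closes nothing; 0 defs / 0 facts / 0 sorry.  Credit: w2-c2 (deep family, ENDs), acc6 (two-exponent
chain), w2-c3 (D-u, StableThree), kim3 (END shape), team n1011 (originals); this seat re-keys.
References: [Kato2004Asterisque] (8.1.3), §9.4, Thm. 9.7, Thm. 6.6 (1), Ex. 13.3; [Kim2022StructureSelmer] Thm. 1.9 (6),
§3.1–§3.3, Thm. 3.13; [MazurRubin2004] Thm. 3.2.4, §3.5 (H.5), Thm. 5.2.12, Cor. 5.2.13, App. A Prop. A.2;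
[Sakamoto2024] Thm. 4.4; [Kim2025RefinedTNC] Thm 1.1, §4.2, §8.1.2; [SilvermanATAEC1994] IV.9.2; cell memo
kim3/KIM3-PROOF.md §14 (Theorem A-t (ii), 14.3 (1a), 14.6 (2)).
-/

set_option autoImplicit false
-- the Theorems namespace of a single-conjunct summit repeats the summit name by design (D-0017)
set_option linter.dupNamespace false

noncomputable section

open scoped Classical NumberField ContRepresentation TensorProduct
open Function Field NumberField IsDedekindDomain IsDedekindDomain.HeightOneSpectrum WeierstrassCurve
  CongruenceSubgroup
  Literature.NumberTheory.EllipticCurves Literature.NumberTheory.EllipticCurves.ModularForms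
  Literature.NumberTheory.EllipticCurves.Rank1Residual
  Literature.NumberTheory.EllipticCurves.Kato2004
  Literature.NumberTheory.EllipticCurves.Kato2004.EulerSystemValues
  Literature.NumberTheory.GaloisRepresentations
  Literature.NumberTheory.GaloisRepresentations.DiscreteGaloisModule Literature.NumberTheory.GaloisCohomology
  Rat.HeightOneSpectrum
  Summit.BirchSwinnertonDyer.Rank1Residual.GaloisImage
  Summit.BirchSwinnertonDyer.Rank1Residual.GaloisImage.Assembly
  Summit.BirchSwinnertonDyer.Rank1Residual.GaloisImage.S24Deep
  Summit.BirchSwinnertonDyer.Rank1Residual.X4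
  Summit.BirchSwinnertonDyer.BirchSwinnertonDyer.Theorems.KimAtThreeKolyvaginUnitLevelOneRungs
  Summit.BirchSwinnertonDyer.BirchSwinnertonDyer.Theorems.KimAtThreeKolyvaginCertificateDictionary
  Summit.BirchSwinnertonDyer.BirchSwinnertonDyer.Theorems.KimAtThreeKolyvaginMinimalCertificate
  Summit.BirchSwinnertonDyer.BirchSwinnertonDyer.Theorems.KimAtThreeDeepLowerKatoStratumOfFacts
  Summit.BirchSwinnertonDyer.BirchSwinnertonDyer.Theorems.KimAtThreeDeepLowerDeepPortWith
  Summit.BirchSwinnertonDyer.BirchSwinnertonDyer.Theorems.KimAtThreeKolyvaginDefs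
  Summit.BirchSwinnertonDyer.BirchSwinnertonDyer.Theorems.KimAtThreeTwoExponentEnd
  Summit.BirchSwinnertonDyer.BirchSwinnertonDyer.Theorems.KimAtThreeDeepLowerOffStratumAdditiveDefectPortTwoExpEnd
  Summit.BirchSwinnertonDyer.BirchSwinnertonDyer.Theorems.KimAtThreeDeepLowerOffStratumAdditiveDefectPortTwoExp
  Summit.BirchSwinnertonDyer.BirchSwinnertonDyer.Theorems.KimAtThreeKolyvaginPortShared

namespace Summit.BirchSwinnertonDyer.BirchSwinnertonDyer.Theorems.KimAtThreeDeepLowerAdditiveTorsionEndOfZetaBody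

variable (W : WeierstrassCurve ℚ) [W.IsElliptic] [W.IsGloballyMinimal]
  [ContinuousSMul ℤ_[3] (W.tateModule 3)] [Module.Free ℤ_[3] (W.tateModule 3)]
  [Module.Finite ℤ_[3] (W.tateModule 3)]

/-- Local notation: the TWO-EXPONENT rider clause (ii₂) at depth `j`, torsion exponent `t`, defect exponent
`e`, place `v`, for the pair `(Λ, Λf)` (n1011's `KatoExpStarFiniteLevelAt` clause (ii), conclusion `× 3^e`). -/
local notation3 (prettyPrint := false) "RIDER₂⟦" W' ", " j ", " t' ", " e' ", " v' ", " Λ' ", " Λf "⟧" =>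
  ∀ (r : Finset (HeightOneSpectrum (𝓞 ℚ)))
    (Ψ : H1 (tateRep W' 3) (cycSubgroup 3 0 r) →+
      continuousCohomology 1
        (subgroupRep (WeierstrassCurve.torsionGaloisModule W' (((3 : ℕ) : ℤ) ^ j * ((3 : ℕ) : ℤ))).toTopRep
          (cycSubgroup 3 0 r))),
    (∀ (φ : contOneCocycles (subgroupRep (tateRep W' 3).toTopRep (cycSubgroup 3 0 r)))
        (ψ : contOneCocycles
          (subgroupRep (WeierstrassCurve.torsionGaloisModule W' (((3 : ℕ) : ℤ) ^ j * ((3 : ℕ) : ℤ))).toTopRep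
            (cycSubgroup 3 0 r))),
        (∀ g, ((ψ.1 g : geomTorsion W' (((3 : ℕ) : ℤ) ^ j * ((3 : ℕ) : ℤ))) : geomPoints W') =
          TateModule.proj 3 (j + 1) (φ.1 g)) →
        Ψ (oneCocycleClass _ φ) = oneCocycleClass _ ψ) →
    ∀ (y : H1 (tateRep W' 3) (cycSubgroup 3 0 r))
      (κ₀ : galoisCohomology (WeierstrassCurve.torsionGaloisModule W' (((3 : ℕ) : ℤ) ^ j * ((3 : ℕ) : ℤ))) 1)
      (s : ℤ_[3]),
      resSubgroup (WeierstrassCurve.torsionGaloisModule W' (((3 : ℕ) : ℤ) ^ j * ((3 : ℕ) : ℤ))).toTopRep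
          (cycSubgroup 3 0 r) 1 κ₀ = Ψ y →
      galoisCohomology.localization (WeierstrassCurve.torsionGaloisModule W' (((3 : ℕ) : ℤ) ^ j * ((3 : ℕ) : ℤ)))
          (Sum.inr v') 1 κ₀ ∈ propagatedSelmerStructure W' 3 j (Sum.inr v') →
      (∃ l ∈ cycIntLattice 3 (cycLevel 3 0 r),
          (((3 : ℕ) : ℤ_[3]) ^ t') • Λ' 0 r y - ((s : ℚ_[3]) ⊗ₜ[ℚ] (1 : CyclotomicField (cycLevel 3 0 r) ℚ)) =
            (((3 : ℕ) : ℤ_[3]) ^ (j + 1)) • (l : ℚ_[3] ⊗[ℚ] CyclotomicField (cycLevel 3 0 r) ℚ)) →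
      ((3 ^ e' : ℕ) : ZMod (3 ^ (j + 1))) *
        Λf (galoisCohomology.localization
          (WeierstrassCurve.torsionGaloisModule W' (((3 : ℕ) : ℤ) ^ j * ((3 : ℕ) : ℤ))) (Sum.inr v') 1 κ₀) =
        PadicInt.toZModPow (j + 1) s

set_option backward.isDefEq.respectTransparency false in
/-- **§1 Cor C-t on `[0]⁺_f`, every `t`, every defect exponent `e`, every depth, every torsion-stabilisation
level `N₀`, PORT-FREE, from Kato's `ZetaBody`.**  `W/ℚ` globally minimal, ADDITIVE at `3`, the `3`-adic tower onto,
`#E(ℚ₃)[3] = 3^t`, a parametrisation datum `P` at the conductor with `[0]⁺_{P.f} ≠ 0` (analytic rank `0`);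
DISPLAYED: `hS24d`/`hS24d₂`, `hGZK`, `hPT`, generators `η`, Kato's witnesses through `hbody` for `P.f`, the
functionals `Λfin j` with the (Λ)-clauses `hΛ` and the two-exponent riders `hfin₂` at torsion exponent `t`, `hcdA`,
the torsion-stabilisation binder `hstab` of level `N₀` over `3` (`3^{N₀+1}·Q = 0 → 3^{N₀}·Q = 0` on `E(ℚ_w)`) and
n1011's level-free value certificates (`hNorm`/`hκ0`, `d′`/`hcd`/`hdd′`, `hAN`, `aM`/`haM`, `hE0`/`hE`, `hR0`/`hR`);
a depth `k`, modulus `3^j`, `t + j ≤ k + 1`, a MINIMAL certificate at a cyclic `n ∈ 𝒩_{k+N₀+1}(E,3)` with `ℓ ∤ N`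
for `ℓ ∣ n` ⟹ `ord₃ [0]⁺_{P.f} ≤ ord₃ #Ш(E/ℚ)(3) + (j − 1)`.  Proof = this seat's gen-2
`padicValRat_ratPlusSymbol_le_of_towerSurj_deep_twoExp` with w2-c2's shared-`η` deep family built at depth parameter
`N₀` (primes of `D′ k′` in the Frobenius class of depth `max k k′ + N₀`, i.e. Kolyvagin of level `3^{k′+N₀+1}`) and
the two-level dictionary `KatoKuriharaDictionaryThreeAt₂AtTwoExp W t e k k′ (D′ k) (D′ k′) (red k′) v₃ P` on THAT
family taken from ★★-stable (`exists_katoKuriharaWitnessAtTwoExp_pair_of_zetaBody_of_stable_of_unramified`) with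
the value rows of `ValueRow.valueRow_of_zetaBody` at `t`, ending in gen-2 §1 one class deeper.
[cite: Kim2022StructureSelmer, Thm. 1.9 (6) and Thm. 3.13] [cite: Sakamoto2024, Thm. 4.4 (p. 926)]
[cite: MazurRubin2004, §3.5 (H.5) (p. 27), Thm. 3.2.4 and App. A Prop. A.2 (pp. 79–80)]
[cite: Kato2004Asterisque, (8.1.3) (p. 180), §9.4 (p. 188), Thm. 9.7 (p. 189), Thm. 6.6 (1) (p. 163), Ex. 13.3 (pp. 224–225)]
[cite: MilneADT2006, Ch. I, Thm. 4.10] -/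
theorem padicValRat_ratPlusSymbol_le_of_towerSurj_deep_twoExp_of_zetaBody_of_stable
    (hS24d : S24Deep.kolyvaginSystems_freeRankOne_zmod_three_pow_deep)
    (hS24d₂ : S24Deep.kolyvaginSystems_idealOfBasis_eq_fittingIdeal_zmod_three_pow_deep)
    (hGZK : rank_eq_analyticRank_of_analyticRank_le_one)
    (hPT : poitouTate_selmerStructure_duality ℚ)
    (t e k N₀ : ℕ)
    (hadd : haveI : Fact (Nat.Prime 3) := ⟨Nat.prime_three⟩; Addv W 3)
    (htower : ∀ m : ℕ, W.HasSurjectiveModNGaloisRep (3 ^ m : ℕ))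
    (ht : Nat.card {Q : (W.baseChange ℚ_[3]).toAffine.Point // (3 : ℕ) • Q = 0} = 3 ^ t)
    {N : ℕ} [NeZero N] (P : ModularParametrizationData W N) (hN : N = W.conductorNorm ℤ)
    (h0 : ratPlusSymbol P.f 0 ≠ 0)
    (v₃ : HeightOneSpectrum (𝓞 ℚ)) (hv₃ : ((3 : ℕ) : 𝓞 ℚ) ∈ v₃.asIdeal)
    (η : (q : HeightOneSpectrum (𝓞 ℚ)) → (ZMod (Ideal.absNorm q.asIdeal))ˣ)
    (hη : ∀ q : HeightOneSpectrum (𝓞 ℚ), Subgroup.zpowers (η q) = ⊤)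
    -- Kato's witnesses for `P.f` (BOUND in `hbody`), the finite-level functionals with (Λ) + (ii₂) at torsion `t`
    {ι : (n : ℕ) → (CyclotomicField n ℚ →+* ℂ)} {κK : ℝ}
    {Λ : ∀ (k' : ℕ) (r : Finset (HeightOneSpectrum (𝓞 ℚ))),
      H1 (tateRep W 3) (cycSubgroup 3 k' r) →ₗ[ℤ_[3]] ℚ_[3] ⊗[ℚ] CyclotomicField (cycLevel 3 k' r) ℚ}
    {c d a : ℤ} {A : ℕ} [NeZero A]
    {z : ∀ (k' : ℕ) (r : (cyclotomicLevelsRat 3 (badPlaces c d A N)).Ideals),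
      H1 (tateRep W 3) ((cyclotomicLevelsRat 3 (badPlaces c d A N)).level k' r.1)}
    {x : ∀ (k' : ℕ) (r : (cyclotomicLevelsRat 3 (badPlaces c d A N)).Ideals),
      CyclotomicField (cycLevel 3 k' r.1) ℚ}
    (hbody : ZetaBody W 3 P.f ι κK Λ c d a A z x)
    (Λfin : ∀ j : ℕ, galoisCohomology ((W.torsionGaloisModule (((3 : ℕ) : ℤ) ^ j * ((3 : ℕ) : ℤ))).toLocal
      (Sum.inr v₃)) 1 →+ ZMod (3 ^ (j + 1)))
    (hΛ : ∀ j : ℕ,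
      (∀ c : ZMod (3 ^ (j + 1)), ∃ x ∈ propagatedSelmerStructure W 3 j (Sum.inr v₃), Λfin j x = c) ∧
      (∀ x ∈ propagatedSelmerStructure W 3 j (Sum.inr v₃),
        Λfin j x = 0 ↔ x ∈ W.kummerSelmerStructure (((3 : ℕ) : ℤ) ^ j * ((3 : ℕ) : ℤ)) (Sum.inr v₃)))
    (hfin₂ : ∀ j : ℕ, RIDER₂⟦W, j, t, e, v₃, Λ, Λfin j⟧)
    (hcdA : ∀ q : ℕ, q.Prime → q ≡ 1 [MOD 3] → ¬ q ∣ 2 * c.natAbs * d.natAbs * A)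
    -- the torsion-stabilisation level `N₀` over `3` (no `ℚ_w`-point of order `3^{N₀+1}`)
    (hstab : ∀ w : HeightOneSpectrum (𝓞 ℚ), ((primesEquiv w : Nat.Primes) : ℕ) = 3 →
      ∀ Q : (W.baseChange (w.adicCompletion ℚ)).toAffine.Point, 3 ^ (N₀ + 1) • Q = 0 → 3 ^ N₀ • Q = 0)
    -- the level-free VALUE certificates (n1011 T-PK6-VDIS)
    (hNorm : ∃ u : ℚ, (u : ℝ) = κK ∧ padicValRat 3 u = 0) (hκ0 : κK ≠ 0)
    (d' : ℤ) (hcd : Int.gcd (c * d) A = 1) (hdd' : d * d' ≡ 1 [ZMOD (A : ℤ)])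
    (hAN : Nat.Coprime A N)
    (aM : ℕ → ℤ) (haM : ∀ q ∈ (3 * A).primeFactors, cuspCoeff P.f q = aM q)
    (hE0 : ∏ q ∈ (3 * A).primeFactors, (1 - (aM q : ℚ) / q + (if q ∣ N then 0 else (1 / q : ℚ))) ≠ 0)
    (hE : padicValRat 3
      (∏ q ∈ (3 * A).primeFactors, (1 - (aM q : ℚ) / q + (if q ∣ N then 0 else (1 / q : ℚ)))) = 0)
    (hR0 : (c : ℚ) ^ 2 * (d : ℚ) ^ 2 * ratMinusSymbol P.f ((a : ℚ) / A) -
        (c : ℚ) * (d : ℚ) ^ 2 * ratMinusSymbol P.f ((a * c : ℚ) / A) -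
        (c : ℚ) ^ 2 * (d : ℚ) * ratMinusSymbol P.f ((a * d' : ℚ) / A) +
        (c : ℚ) * (d : ℚ) * ratMinusSymbol P.f ((a * c * d' : ℚ) / A) ≠ 0)
    (hR : padicValRat 3 ((c : ℚ) ^ 2 * (d : ℚ) ^ 2 * ratMinusSymbol P.f ((a : ℚ) / A) -
        (c : ℚ) * (d : ℚ) ^ 2 * ratMinusSymbol P.f ((a * c : ℚ) / A) -
        (c : ℚ) ^ 2 * (d : ℚ) * ratMinusSymbol P.f ((a * d' : ℚ) / A) +
        (c : ℚ) * (d : ℚ) * ratMinusSymbol P.f ((a * c * d' : ℚ) / A)) = 0)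
    -- the certificate
    (n : ℕ) [NeZero n] (hn : Kato.IsKolyvaginProduct W 3 (k + N₀ + 1) n)
    (hcyc : ∀ (ℓ : ℕ) [Fact ℓ.Prime], ℓ ∣ n →
      Nat.card {P : ((integralModelInt W).map (Int.castRingHom (ZMod ℓ))).toAffine.Point //
        3 • P = 0} ≤ 3)
    (hnN : ∀ ℓ ∈ n.primeFactors, ¬ ℓ ∣ N) {j : ℕ} (htj : t + j ≤ k + 1)
    (ψ : (ℓ : ℕ) → (ZMod ℓ)ˣ →* Multiplicative (ZMod (3 ^ j)))
    (hψ : ∀ ℓ ∈ n.primeFactors, Function.Surjective (ψ ℓ))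
    (hcert : kuriharaNumber P.f (3 ^ j) n ψ ≠ 0)
    (hv : ∀ d : ℕ, d ∣ n → 1 < d → d < n → ∀ [NeZero d], kuriharaNumber P.f (3 ^ j) d ψ = 0) :
    padicValRat 3 (ratPlusSymbol P.f 0) ≤
      (padicValNat 3 (Nat.card (AddCommGroup.primaryComponent W.sha 3)) : ℤ) + ((j - 1 : ℕ) : ℤ) := by
  haveI : Fact (Nat.Prime 3) := ⟨Nat.prime_three⟩
  have hL : W.entireLFunction 1 ≠ 0 :=
    P.isNewformOf.entireLFunction_one_ne_zero_of_ratPlusSymbol_zero_ne_zero h0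
  have hr : W.analyticRank = 0 := analyticRank_eq_zero_of_entireLFunction_one_ne_zero hL
  have hGZ := hGZK W (by rw [hr]; exact zero_le_one)
  haveI : Finite W.sha := hGZ.2
  haveI : Finite W.toAffine.Point := W.mordellWeilRank_eq_zero_iff_holds.mp (by rw [hGZ.1, hr])
  have hsurj : W.HasSurjectiveModNGaloisRep ((3 : ℕ) : ℤ) := by simpa using htower 1
  have hirr : W.HasIrreducibleModPGaloisRep 3 :=
    hasIrreducibleModPGaloisRep_of_hasSurjectiveModNGaloisRep W 3 hsurj
  have hpN : 3 ^ 2 ∣ N := hN ▸ KimAtThreeKolyvaginPortShared.sq_dvd_conductorNorm_of_addv W hadd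
  obtain ⟨inv, hperf, hsum, -, hcompl⟩ := hPT 3
  obtain ⟨inv', hperf', hsum', hcompl', hinj'⟩ := exists_localInvariants_three_pow_of_poitouTate hPT
  have hEP : ∀ v : HeightOneSpectrum (𝓞 ℚ), localEulerPoincareCharacteristic (v.adicCompletion ℚ) :=
    localEulerPoincareCharacteristic_rat
  obtain ⟨T, h3T, hbadT, hTmem, hT, h𝓕T, h𝓚T, hfinT, hfinS⟩ := TowerPackage.towerAdmissible W
  have hS : ∀ w : InfinitePlace ℚ, (Sum.inl w : Place ℚ) ∈ finSupport T := inl_mem_finSupport T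
  have h3S : ∀ v : HeightOneSpectrum (𝓞 ℚ), ((3 : ℕ) : 𝓞 ℚ) ∈ v.asIdeal →
      (Sum.inr v : Place ℚ) ∈ finSupport T := fun v hv => (inr_mem_finSupport_iff T v).mpr (h3T v hv)
  have hbadS : ∀ v : HeightOneSpectrum (𝓞 ℚ), ¬ W.HasGoodReductionAt v →
      (Sum.inr v : Place ℚ) ∈ finSupport T := fun v hv => (inr_mem_finSupport_iff T v).mpr (hbadT v hv)
  have hSgood : ∀ v ∉ {v : HeightOneSpectrum (𝓞 ℚ) | (Sum.inr v : Place ℚ) ∈ finSupport T},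
      W.HasGoodReductionAt v ∧ ((3 : ℕ) : 𝓞 ℚ) ∉ v.asIdeal := fun v hv =>
    ⟨by_contra fun h => hv (hbadS v h), fun h => hv (h3S v h)⟩
  have hSmem : ∀ v ∈ {v : HeightOneSpectrum (𝓞 ℚ) | (Sum.inr v : Place ℚ) ∈ finSupport T},
      ¬ W.HasGoodReductionAt v ∨ ((3 : ℕ) : 𝓞 ℚ) ∈ v.asIdeal := fun v hv =>
    hTmem v ((inr_mem_finSupport_iff T v).mp hv)
  obtain ⟨τ, hτμ, hτq⟩ := S24Deep.exists_tau_forall_levels_of_towerSurj W htower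
  -- w2-c2's shared-`η` deep family, built at depth parameter `N₀` (NOT `t`)
  obtain ⟨D', g', hP', hDT', hD', hPP', hPS', hUT', hg', hgo', hgen', hR22'⟩ :=
    exists_deepFamily_of_towerSurj_with W hS24d hS24d₂ N₀ k htower τ hτμ hτq inv hperf hsum hcompl hEP
      (finSupport T) hS h3S hbadS hfinT η hη
  choose red hred using fun k' => exists_torsionReduction_three W k k'
  -- the primes of the family are Kolyvagin primes `N₀` levels deeper than their depth (E1-deep on the classes)
  have hKol : ∀ k', k ≤ k' → ∀ q ∈ (D' k').primes,
      Kato.IsKolyvaginPrime W 3 (k' + N₀ + 1) ((primesEquiv q : Nat.Primes) : ℕ) := fun k' hkk' q hq =>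
    KolyvaginPrime.isKolyvaginPrime_of_mem_frobeniusClassPrimes_of_le W (j := k' + N₀) (m := max k k' + N₀)
      (by omega) (fun v hv => (hSgood v hv).1) (hτμ _) (hτq _) ((hP' k').le hq)
  -- every Kolyvagin prime is a usable prime of Kato's system for `(c, d, A, N)`
  have husable : ∀ (j : ℕ) (q : HeightOneSpectrum (𝓞 ℚ)),
      Kato.IsKolyvaginPrime W 3 (j + 1) ((primesEquiv q : Nat.Primes) : ℕ) →
        q ∈ (cyclotomicLevelsRat 3 (badPlaces c d A N)).primes := by
    intro j q hq
    have hℓ := hq.prime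
    have h13 : ((primesEquiv q : Nat.Primes) : ℕ) ≡ 1 [MOD 3] :=
      hq.modEq_one.of_dvd (dvd_pow_self 3 (Nat.succ_ne_zero j))
    refine (mem_primes_cyclotomicLevelsRat_badPlaces_iff 3 c d A N q).2 ⟨fun hdvd => ?_, hq.ne⟩
    rcases (Nat.Prime.dvd_mul hℓ).mp hdvd with h | h
    · exact hcdA _ hℓ h13 h
    · apply hq.not_dvd
      rw [← hN]
      exact dvd_mul_of_dvd_left h 3
  have hPr : ∀ k', k ≤ k' → (D' k').primes ⊆ (cyclotomicLevelsRat 3 (badPlaces c d A N)).primes :=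
    fun k' hkk' q hq => husable (k' + N₀) q (hKol k' hkk' q hq)
  -- the value rows at torsion exponent `t`, on the primes of the family (n1011 T-PK6-VDIS)
  have hval : ∀ (k' : ℕ) (hkk' : k ≤ k'), ∀ σ : HeightOneSpectrum (𝓞 ℚ) → absoluteGaloisGroup ℚ,
      (∀ q, σ q ∈ (adicCompletionPrime ℚ q).inertia (absoluteGaloisGroup ℚ)) →
      (∀ q, modNCyclotomicCharacter ℚ (Ideal.absNorm q.asIdeal) (σ q) = η q) →
      ∀ (r : Finset (HeightOneSpectrum (𝓞 ℚ))) (hr : (↑r : Set _) ⊆ (D' k').primes),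
        ∃ (s : ℤ_[3]) (u : (ZMod (3 ^ (k' + 1)))ˣ)
          (ψ' : (ℓ : ℕ) → (ZMod ℓ)ˣ →* Multiplicative (ZMod (3 ^ (k' + 1)))),
          (∀ q ∈ r, Function.Surjective (ψ' (Ideal.absNorm q.asIdeal))) ∧
          (∃ l ∈ cycIntLattice 3 (cycLevel 3 0 r),
            (((3 : ℕ) : ℤ_[3]) ^ t) • ((1 : ℚ_[3]) ⊗ₜ[ℚ]
              ((r.noncommProd (fun ℓ : HeightOneSpectrum (𝓞 ℚ) =>
                  ∑ j ∈ Finset.range (((primesEquiv ℓ : Nat.Primes) : ℕ) - 1),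
                    (j : Module.End ℚ (CyclotomicField (cycLevel 3 0 r) ℚ)) *
                      (sigma (cycLevel 3 0 r) (modNCyclotomicCharacter ℚ (cycLevel 3 0 r) (σ ℓ)) :
                        CyclotomicField (cycLevel 3 0 r) ℚ →ₐ[ℚ]
                          CyclotomicField (cycLevel 3 0 r) ℚ).toLinearMap ^ j)
                (ZetaValue.pairwise_commute_fieldDeriv (cycLevel 3 0 r)
                  (fun ℓ => modNCyclotomicCharacter ℚ (cycLevel 3 0 r) (σ ℓ))
                  (fun ℓ => ((primesEquiv ℓ : Nat.Primes) : ℕ) - 1) r))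
                (x 0 ⟨r, fun _ hq => hPr k' hkk' (hr (Finset.mem_coe.2 hq))⟩ +
                  sigma (cycLevel 3 0 r) (-1) (x 0 ⟨r, fun _ hq => hPr k' hkk' (hr (Finset.mem_coe.2 hq))⟩)))) -
              ((s : ℚ_[3]) ⊗ₜ[ℚ] (1 : CyclotomicField (cycLevel 3 0 r) ℚ)) =
            (((3 : ℕ) : ℤ_[3]) ^ (k' + 1)) • (l : ℚ_[3] ⊗[ℚ] CyclotomicField (cycLevel 3 0 r) ℚ)) ∧
          haveI : NeZero (∏ q ∈ r, Ideal.absNorm q.asIdeal) :=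
            ⟨Finset.prod_ne_zero_iff.2 fun q _ h => q.ne_bot (Ideal.absNorm_eq_zero_iff.1 h)⟩
          PadicInt.toZModPow (k' + 1) s = (u : ZMod (3 ^ (k' + 1))) *
            ((3 : ℕ) : ZMod (3 ^ (k' + 1))) ^ t *
              kuriharaNumber P.f (3 ^ (k' + 1)) (∏ q ∈ r, Ideal.absNorm q.asIdeal) ψ' :=
    fun k' hkk' σ hσI hσχ r hr =>
      ValueRow.valueRow_of_zetaBody hbody P.isNewformOf (by decide) hirr hNorm hκ0 d' hcd hdd' hAN hpN aM haM
        hE0 hE hR0 hR η k' t σ hσI hσχ r (fun q hq => hPr k' hkk' (hr (Finset.mem_coe.2 hq)))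
        (fun q hq => (hKol k' hkk' q (hr (Finset.mem_coe.2 hq))).mono (by omega))
        (fun q hq => (hD' k').zpowers_eq_top (hr (Finset.mem_coe.2 hq)))
  -- the two-level dictionary ON THE FAMILY, from ★★-stable (THEOREM D-u PAIR-STABLE; no port)
  have hdict : ∀ k', k ≤ k' → KatoKuriharaDictionaryThreeAt₂AtTwoExp W t e k k' (D' k) (D' k') (red k') v₃ P := by
    intro k' hkk' _ _ _ _ _ _
    obtain ⟨κf, κu, h₁, h₂, h₃⟩ :=
      KimAtThreeTwoExponentWitnessPairStable.exists_katoKuriharaWitnessAtTwoExp_pair_of_zetaBody_of_stable_of_unramified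
        W P hbody hirr hkk' (red k') (hred k') hv₃ (hΛ k) (hΛ k') (hfin₂ k) (hfin₂ k') (D' k) (hDT' k)
        (D' k') (hDT' k') (hD' k) (hD' k') (hPr k le_rfl) (hPr k' hkk') hstab (hKol k le_rfl) (hKol k' hkk')
        (hval k le_rfl) (hval k' hkk')
    exact ⟨κf, Λfin k, κf, κu, Λfin k', κu, h₁, h₂, fun l hl' hl => ⟨h₃ l hl' hl, h₃ l hl' hl⟩⟩
  have hsurjK : W.HasSurjectiveModNGaloisRep (((3 : ℕ) : ℤ) ^ (max k k + N₀) * ((3 : ℕ) : ℤ)) := by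
    simpa only [Nat.cast_pow, Nat.cast_mul, pow_succ] using htower (max k k + N₀ + 1)
  have hn' : Kato.IsKolyvaginProduct W 3 (max k k + N₀ + 1) n := by rw [max_self]; exact hn
  -- gen-2 §1 at class exponent `max k k + N₀`, shallow datum `D′ k`
  exact padicValRat_ratPlusSymbol_le_of_kolyvaginProduct_nested_twoExp_deep W t e k (max k k + N₀) (D' k) v₃ hv₃
    hadd hsurj ht P h0 (hDT' k) (g' k) (hg' k) (hgen' k) D' hDT' (fun k' _ => hPP' k') red hred
    hdict g' hg' hgo' hgen' inv' hperf' hsum' hcompl' hinj' hEP (fun _ => T) (fun _ => h3T v₃ hv₃) hT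
    h𝓕T h𝓚T hfinT hfinS
    (fun q hq => fun h => hPS' k q hq ((inr_mem_finSupport_iff T q).mpr h))
    (fun k' q hq => fun h => hPS' k' q hq ((inr_mem_finSupport_iff T q).mpr h))
    (hUT' k) hUT'
    (fun d hd => hR22' k (inv' k) (hperf' k) (hsum' k) (hcompl' k) d hd)
    (fun k' d hd => hR22' k' (inv' k') (hperf' k') (hsum' k') (hcompl' k') d hd)
    (hτμ _) (hτq _) (hP' k) hsurjK n hn'
    (fun v hv => natCard_torsionBy_reductionAt_le_of_dvd W 3 hcyc hv)
    (fun v hv h => by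
      obtain ⟨hgood, h3⟩ := hasGoodReductionAt_and_not_mem_of_kolyvaginProduct W 3 hn hv
      rcases hSmem v h with hbad | h3v
      · exact hbad hgood
      · exact h3 h3v)
    hnN htj ψ hψ hcert hv

/-- **§2 Crux `DeepLowerAtThreeOffKatoStratum`'s conclusion on an ADDITIVE row, every `t`, every `e`, every
torsion-stabilisation level `N₀`, PORT-FREE, from Kato's `ZetaBody`.**  Row: `W/ℚ` globally minimal, ADDITIVE at
`3`, the `3`-adic tower onto, `#E(ℚ₃)[3] = 3^t`, a parametrisation datum `D` at the conductor with `ord(δ̃) = 0`;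
DISPLAYED: `hS24d`/`hS24d₂`, `hGZK`, `hPT`, generators `η`, the ZetaBody package for `D.f` at `(t, e, v₃)` (§1's
`hbody`, `Λfin`/`hΛ`, `hfin₂`, `hcdA`, value certificates) and `hstab` of level `N₀`: THEN
`∂^{(∞)}_deep(δ̃) = d ∈ ℕ` and `∂⁽⁰⁾(δ̃) ≤ ord₃ #Ш(E/ℚ)(3) + d` for `(W, D.f)` — gen-2 §3's END-shape bound at
`K = t + N₀ + 1` over §1 at depth `k = L − N₀ − 1` (Kim's Theorem A-t (ii), LOWER half, deep limit).
[cite: Kim2025RefinedTNC, Thm 1.1 and §8.1.2] [cite: Kim2022StructureSelmer, Thm. 1.9 (6), §1.5.1, Thm. 3.13]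
[cite: Sakamoto2024, Thm. 4.4 (p. 926)] [cite: MazurRubin2004, Thm. 5.2.12, Cor. 5.2.13 and App. A Prop. A.2] -/
theorem deepLower_datum_of_zetaBody_of_stable
    (hS24d : S24Deep.kolyvaginSystems_freeRankOne_zmod_three_pow_deep)
    (hS24d₂ : S24Deep.kolyvaginSystems_idealOfBasis_eq_fittingIdeal_zmod_three_pow_deep)
    (hGZK : rank_eq_analyticRank_of_analyticRank_le_one)
    (hPT : poitouTate_selmerStructure_duality ℚ)
    (t e N₀ : ℕ)
    (hadd : haveI : Fact (Nat.Prime 3) := ⟨Nat.prime_three⟩; Addv W 3)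
    (htower : ∀ m : ℕ, W.HasSurjectiveModNGaloisRep (3 ^ m : ℕ))
    (ht : Nat.card {Q : (W.baseChange ℚ_[3]).toAffine.Point // (3 : ℕ) • Q = 0} = 3 ^ t)
    {N : ℕ} [NeZero N] (hNc : N = W.conductorNorm ℤ) (D : ModularParametrizationData W N)
    (v₃ : HeightOneSpectrum (𝓞 ℚ)) (hv₃ : ((3 : ℕ) : 𝓞 ℚ) ∈ v₃.asIdeal)
    (η : (q : HeightOneSpectrum (𝓞 ℚ)) → (ZMod (Ideal.absNorm q.asIdeal))ˣ)
    (hη : ∀ q : HeightOneSpectrum (𝓞 ℚ), Subgroup.zpowers (η q) = ⊤)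
    {ι : (n : ℕ) → (CyclotomicField n ℚ →+* ℂ)} {κK : ℝ}
    {Λ : ∀ (k' : ℕ) (r : Finset (HeightOneSpectrum (𝓞 ℚ))),
      H1 (tateRep W 3) (cycSubgroup 3 k' r) →ₗ[ℤ_[3]] ℚ_[3] ⊗[ℚ] CyclotomicField (cycLevel 3 k' r) ℚ}
    {c d a : ℤ} {A : ℕ} [NeZero A]
    {z : ∀ (k' : ℕ) (r : (cyclotomicLevelsRat 3 (badPlaces c d A N)).Ideals),
      H1 (tateRep W 3) ((cyclotomicLevelsRat 3 (badPlaces c d A N)).level k' r.1)}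
    {x : ∀ (k' : ℕ) (r : (cyclotomicLevelsRat 3 (badPlaces c d A N)).Ideals),
      CyclotomicField (cycLevel 3 k' r.1) ℚ}
    (hbody : ZetaBody W 3 D.f ι κK Λ c d a A z x)
    (Λfin : ∀ j : ℕ, galoisCohomology ((W.torsionGaloisModule (((3 : ℕ) : ℤ) ^ j * ((3 : ℕ) : ℤ))).toLocal
      (Sum.inr v₃)) 1 →+ ZMod (3 ^ (j + 1)))
    (hΛ : ∀ j : ℕ,
      (∀ c : ZMod (3 ^ (j + 1)), ∃ x ∈ propagatedSelmerStructure W 3 j (Sum.inr v₃), Λfin j x = c) ∧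
      (∀ x ∈ propagatedSelmerStructure W 3 j (Sum.inr v₃),
        Λfin j x = 0 ↔ x ∈ W.kummerSelmerStructure (((3 : ℕ) : ℤ) ^ j * ((3 : ℕ) : ℤ)) (Sum.inr v₃)))
    (hfin₂ : ∀ j : ℕ, RIDER₂⟦W, j, t, e, v₃, Λ, Λfin j⟧)
    (hcdA : ∀ q : ℕ, q.Prime → q ≡ 1 [MOD 3] → ¬ q ∣ 2 * c.natAbs * d.natAbs * A)
    (hstab : ∀ w : HeightOneSpectrum (𝓞 ℚ), ((primesEquiv w : Nat.Primes) : ℕ) = 3 →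
      ∀ Q : (W.baseChange (w.adicCompletion ℚ)).toAffine.Point, 3 ^ (N₀ + 1) • Q = 0 → 3 ^ N₀ • Q = 0)
    (hNorm : ∃ u : ℚ, (u : ℝ) = κK ∧ padicValRat 3 u = 0) (hκ0 : κK ≠ 0)
    (d' : ℤ) (hcd : Int.gcd (c * d) A = 1) (hdd' : d * d' ≡ 1 [ZMOD (A : ℤ)])
    (hAN : Nat.Coprime A N)
    (aM : ℕ → ℤ) (haM : ∀ q ∈ (3 * A).primeFactors, cuspCoeff D.f q = aM q)
    (hE0 : ∏ q ∈ (3 * A).primeFactors, (1 - (aM q : ℚ) / q + (if q ∣ N then 0 else (1 / q : ℚ))) ≠ 0)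
    (hE : padicValRat 3
      (∏ q ∈ (3 * A).primeFactors, (1 - (aM q : ℚ) / q + (if q ∣ N then 0 else (1 / q : ℚ)))) = 0)
    (hR0 : (c : ℚ) ^ 2 * (d : ℚ) ^ 2 * ratMinusSymbol D.f ((a : ℚ) / A) -
        (c : ℚ) * (d : ℚ) ^ 2 * ratMinusSymbol D.f ((a * c : ℚ) / A) -
        (c : ℚ) ^ 2 * (d : ℚ) * ratMinusSymbol D.f ((a * d' : ℚ) / A) +
        (c : ℚ) * (d : ℚ) * ratMinusSymbol D.f ((a * c * d' : ℚ) / A) ≠ 0)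
    (hR : padicValRat 3 ((c : ℚ) ^ 2 * (d : ℚ) ^ 2 * ratMinusSymbol D.f ((a : ℚ) / A) -
        (c : ℚ) * (d : ℚ) ^ 2 * ratMinusSymbol D.f ((a * c : ℚ) / A) -
        (c : ℚ) ^ 2 * (d : ℚ) * ratMinusSymbol D.f ((a * d' : ℚ) / A) +
        (c : ℚ) * (d : ℚ) * ratMinusSymbol D.f ((a * c * d' : ℚ) / A)) = 0)
    (hord : kuriharaVanishingOrder W 3 D.f = 0) :
    ∃ d₀ : ℕ, kuriharaPartialDeepInfty W 3 D.f = d₀ ∧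
      kuriharaPartial W 3 D.f 0 ≤
        ((padicValNat 3 (Nat.card (AddCommGroup.primaryComponent W.sha 3)) + d₀ : ℕ) : ℕ∞) := by
  haveI : Fact (Nat.Prime 3) := ⟨Nat.prime_three⟩
  have h0 : ratPlusSymbol D.f 0 ≠ 0 :=
    ratPlusSymbol_zero_ne_zero_of_kuriharaVanishingOrder_eq_zero W 3 D.f hord
  refine deepLower_datum_of_plusSymbolEndShapeBound W htower D hord (t + N₀ + 1) ?_
  intro j' L n hj' hKL hcyc hLn ψ hψ hne hv
  haveI : NeZero n := ⟨hLn.ne_zero⟩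
  have hk : L - N₀ - 1 + N₀ + 1 = L := by omega
  have hn' : Kato.IsKolyvaginProduct W 3 (L - N₀ - 1 + N₀ + 1) n := by rw [hk]; exact hLn
  exact padicValRat_ratPlusSymbol_le_of_towerSurj_deep_twoExp_of_zetaBody_of_stable W hS24d hS24d₂ hGZK hPT t e
    (L - N₀ - 1) N₀ hadd htower ht D hNc h0 v₃ hv₃ η hη hbody Λfin hΛ hfin₂ hcdA hstab hNorm hκ0 d' hcd hdd' hAN
    aM haM hE0 hE hR0 hR n hn' (fun ℓ _ hℓ => hcyc.2 ℓ hℓ)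
    (fun ℓ hℓ hℓN => (hLn.2 ℓ hℓ).not_dvd_conductorNorm (hNc ▸ hℓN)) (j := j') (by omega) ψ hψ hne hv

end Summit.BirchSwinnertonDyer.BirchSwinnertonDyer.Theorems.KimAtThreeDeepLowerAdditiveTorsionEndOfZetaBody

end
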